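import Summits.Ventures.HSemireg.WedgeHankelSubstitutionJordanPartition

/-!
# Venture HSemireg — AN EXPLICIT JORDAN BASIS OF THE SHEAR ON TH-7's CLASSES IN CHARACTERISTIC `p`: the iterates `J_m := N^{m mod p} E_{p⌊m/p⌋}` (`N = SbC(1 λ 0 1) − 1`,
# `λ ≠ 0`, `m ≤ n`) are a basis; `N J_m = J_{m+1}` inside a block and `N J_m = 0` at the end of a block (`m + 1 ≡ 0 (p)` or `m = n`), so the blocks are the `⌊n/p⌋` chains
# `E_{ip}, N E_{ip}, …, N^{p−1} E_{ip}` of length `p` and the chain of `E_{p⌊n/p⌋}` of length `n mod p + 1`; the KERNEL FLAG `ker N^k` and the IMAGE FLAG `range N^k` are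
# the spans of the top / bottom `k` vectors of every chain (for `p ≤ n` they are NOT spanned by spikes, K6)

HONEST FRAMING. Part of the Lean index of the computation cell `pub-hsemireg` (seat p10 gen 22, Sunday typer «UNIFORM-IN-n»).
Finite-dimensional EXTERIOR ALGEBRA + linear algebra ONLY: no variety, no cohomology theory, no sheaf, no Ext group, no semiregularity map;
nothing here says that HC / HC_CM / HC_AV holds; no Literature fact is declared or used.  Custodian versions as in `WedgeHankelSiegelIdeal` (1/3) and `WedgeHankelFrameChange`;
the dictionary (the shear = translation of the node acting unipotently on `Sym^n`; in characteristic `p` its Jordan type is `(p, …, p, n mod p + 1)`) is QUOTED, never asserted.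

WHAT IS IN THE TREE.  K1 (`WedgeHankelSubstitutionJordanPartition`): `repr_SbC_shear_sub_one_pow_spikeBasis` (the spike coordinates of `N^k E_i` vanish below `i + k` and equal
`(i+1)⋯(i+k)·λ^k` AT `i + k`), `SbC_shear_sub_one_pow_spikeBasis_eq_zero` (`N^k E_i = 0` for `i + k > n`), `linearIndependent_of_repr_pivot` (ONE shift `k` for the whole family),
`ascFactorial_mul_prime_succ_cast_ne_zero` (`(mp+1)⋯(mp+j) ≠ 0` in characteristic `p` for `j < p`), **`finrank_ker_SbC_shear_sub_one_pow_char`** (`dim ker N^k = ⌊n/p⌋·min(k,p)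
+ min(k, n mod p + 1)` — the Jordan TYPE by dimension counting); J-leaf `SbC_shear_sub_one_pow_char` (`N^p = 0`); K11 (`…ShearCyclic`): the single chain of `E_0` (`dim
min(p, n+1)`); K6 (`…KernelFlag`): `ker N^k = span{E_{n+1−k}, …, E_n}` only when `n!·λ ≠ 0`, and `min_lt_finrank_ker_…_char` (for `p ≤ n` the kernel is strictly bigger than the
top spikes).  No BASIS adapted to the blocks was typed.  THIS FILE (namespace `Summit.Ventures.HSemireg.Wedge.HankelFrameChange` continued; imports K1):
* §313 `linearIndependent_of_pivot` (triangular families with an injective pivot map — K1's lemma without the common shift).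
* §314 THE JORDAN VECTORS `J_m = N^{m mod p} E_{p⌊m/p⌋}` (`λ ≠ 0`, characteristic `p`): `repr_jordan_of_lt` (coordinates vanish below `m`), **`repr_jordan_self`** (the
  `E_m`-coordinate is `(p⌊m/p⌋+1)⋯(p⌊m/p⌋ + m mod p)·λ^{m mod p} ≠ 0`), `jordan_ne_zero`, **`linearIndependent_jordan`**, **`span_jordan_eq_top`** (a BASIS of th-7's class
  space); the CHAINS: **`shear_sub_one_apply_jordan_of_lt`** (`N J_m = J_{m+1}` when `m mod p + 1 < p` and `m < n`), **`pow_shear_sub_one_apply_jordan_of_lt`** (`N^k J_m = J_{m+k}`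
  when `m mod p + k < p`, `m + k ≤ n`), **`pow_shear_sub_one_apply_jordan_eq_zero`** (`N^k J_m = 0` when `m mod p + k ≥ p` or `m + k > n`), `shear_sub_one_apply_jordan_eq_zero_of_mod`
  (end of a full block), `shear_sub_one_apply_jordan_eq_zero_of_eq` (`m = n`: end of the short block).
* §315 THE FLAGS AS SPANS OF JORDAN VECTORS (every `k`): **`ker_pow_shear_sub_one_eq_span_jordan`: `ker N^k = span{J_m : m mod p + k ≥ p ∨ m + k > n}`** (the top `k` vectors of
  every chain; «⊆»: `N^k` maps the other `J_m` to DISTINCT basis vectors `J_{m+k}`), **`range_pow_shear_sub_one_eq_span_jordan`: `range N^k = span{J_m : m mod p ≥ k}`** (the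
  bottom vectors), `jordan_mem_ker_pow_iff`, `jordan_congr`, `jordan_mem_range_pow_of_le`.
NOT typed here: the centralizer of the shear for `p ≤ n` through this basis (dimension `⌊n/p⌋(n+1) + (⌊n/p⌋+1)(n mod p + 1)`; next leaf); parabolic substitutions (K5 transfers
the TYPE; the basis transfers by the frame change); anything Ext-side.  New names only.
-/

open Module

namespace Summit.Ventures.HSemireg.Wedge.HankelFrameChange

open Summit.Ventures.HSemireg.Wedge Summit.Ventures.HSemireg.Wedge.Kunneth Summit.Ventures.HSemireg.Wedge.Hankel
  Summit.Ventures.HSemireg.Wedge.BasisFree Summit.Ventures.HSemireg.Wedge.HankelSiegel Summit.Ventures.HSemireg.Wedge.HankelSiegelIdeal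
  Summit.Ventures.HSemireg.Wedge.KunnethKernel Summit.Ventures.HSemireg.Wedge.HankelRankOne Summit.Ventures.HSemireg.Wedge.KernelDuality

variable (K : Type*) [Field K] {n : ℕ}

/-! ## §313. Triangular families with an injective pivot map are independent -/

/-- **TRIANGULAR FAMILIES ARE INDEPENDENT**: vectors `v i` of the class space with an INJECTIVE pivot map `π` such that the spike coordinates of `v i` vanish below `π i` and do not
vanish at `π i` are linearly independent (look at the coordinate at the smallest pivot carrying a non-zero coefficient). -/
theorem linearIndependent_of_pivot {ι : Type*} (v : ι → spikeSpan K n) (π : ι → Fin (n + 1)) (hπ : Function.Injective π)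
    (hvan : ∀ (i : ι) (a : Fin (n + 1)), (a : ℕ) < (π i : ℕ) → (spikeBasis K n).repr (v i) a = 0) (hpiv : ∀ i, (spikeBasis K n).repr (v i) (π i) ≠ 0) :
    LinearIndependent K v := by
  classical
  rw [linearIndependent_iff']
  intro s g hsum
  by_contra hne
  push Not at hne
  obtain ⟨i₁, hi₁, hgi₁⟩ := hne
  obtain ⟨i₀, hi₀s, hmin⟩ := (s.filter fun i => g i ≠ 0).exists_min_image (fun i => ((π i : Fin (n + 1)) : ℕ)) ⟨i₁, Finset.mem_filter.mpr ⟨hi₁, hgi₁⟩⟩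
  obtain ⟨hi₀, hg₀⟩ := Finset.mem_filter.mp hi₀s
  have h := congrArg (fun f : spikeSpan K n => (spikeBasis K n).repr f (π i₀)) hsum
  simp only [map_sum, map_smul, map_zero, Finsupp.finsetSum_apply, Finsupp.smul_apply, smul_eq_mul, Finsupp.zero_apply] at h
  rw [Finset.sum_eq_single i₀ (fun i hi hne => ?_) (fun h' => absurd hi₀ h')] at h
  · exact mul_ne_zero hg₀ (hpiv i₀) h
  · by_cases hgi : g i = 0
    · rw [hgi, zero_mul]
    · have hle := hmin i (Finset.mem_filter.mpr ⟨hi, hgi⟩)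
      have hne' : ((π i : Fin (n + 1)) : ℕ) ≠ ((π i₀ : Fin (n + 1)) : ℕ) := fun e => hne (hπ (Fin.ext e))
      rw [hvan i (π i₀) (by omega), mul_zero]

/-! ## §314. The Jordan vectors `J_m = N^{m mod p} E_{p⌊m/p⌋}` and their chains -/

/-- the base spike of `J_m` is a spike: `p⌊m/p⌋ ≤ m ≤ n`. -/
theorem mul_div_lt_succ (p : ℕ) (m : Fin (n + 1)) : p * ((m : ℕ) / p) < n + 1 := lt_of_le_of_lt (Nat.mul_div_le (m : ℕ) p) m.2

/-- **the spike coordinates of `J_m = N^{m mod p} E_{p⌊m/p⌋}` vanish below `m`** (K1's leading term: below `p⌊m/p⌋ + m mod p = m`; every field, every `p`). -/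
theorem repr_jordan_of_lt (lam : K) (p : ℕ) (m a : Fin (n + 1)) (ha : (a : ℕ) < (m : ℕ)) :
    (spikeBasis K n).repr (((SbC K 1 lam 0 1 - 1) ^ ((m : ℕ) % p)) (spikeBasis K n ⟨p * ((m : ℕ) / p), mul_div_lt_succ p m⟩)) a = 0 :=
  (repr_SbC_shear_sub_one_pow_spikeBasis K lam ⟨p * ((m : ℕ) / p), mul_div_lt_succ p m⟩ ((m : ℕ) % p)).1 a (by simp only; rw [Nat.div_add_mod]; exact ha)

/-- **the `E_m`-coordinate of `J_m` is `(p⌊m/p⌋ + 1)⋯(p⌊m/p⌋ + m mod p)·λ^{m mod p}`** (every field, every `p`). -/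
theorem repr_jordan_self (lam : K) (p : ℕ) (m : Fin (n + 1)) :
    (spikeBasis K n).repr (((SbC K 1 lam 0 1 - 1) ^ ((m : ℕ) % p)) (spikeBasis K n ⟨p * ((m : ℕ) / p), mul_div_lt_succ p m⟩)) m =
      (((p * ((m : ℕ) / p) + 1).ascFactorial ((m : ℕ) % p) : ℕ) : K) * lam ^ ((m : ℕ) % p) :=
  (repr_SbC_shear_sub_one_pow_spikeBasis K lam ⟨p * ((m : ℕ) / p), mul_div_lt_succ p m⟩ ((m : ℕ) % p)).2 m (by simp only; rw [Nat.div_add_mod])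

/-- **in characteristic `p`, `λ ≠ 0`: that coordinate is NON-ZERO** (`(ip+1)⋯(ip+j) ≡ j! ≢ 0` for `j < p`, K1). -/
theorem repr_jordan_self_ne_zero {lam : K} (hlam : lam ≠ 0) (p : ℕ) [Fact p.Prime] [CharP K p] (m : Fin (n + 1)) :
    (spikeBasis K n).repr (((SbC K 1 lam 0 1 - 1) ^ ((m : ℕ) % p)) (spikeBasis K n ⟨p * ((m : ℕ) / p), mul_div_lt_succ p m⟩)) m ≠ 0 := by
  have hp : p.Prime := Fact.out
  rw [repr_jordan_self, mul_comm p]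
  exact mul_ne_zero (ascFactorial_mul_prime_succ_cast_ne_zero K p ((m : ℕ) / p) (Nat.mod_lt _ hp.pos)) (pow_ne_zero _ hlam)

/-- hence `J_m ≠ 0` (characteristic `p`, `λ ≠ 0`). -/
theorem jordan_ne_zero {lam : K} (hlam : lam ≠ 0) (p : ℕ) [Fact p.Prime] [CharP K p] (m : Fin (n + 1)) :
    ((SbC K 1 lam 0 1 - 1) ^ ((m : ℕ) % p)) (spikeBasis K n ⟨p * ((m : ℕ) / p), mul_div_lt_succ p m⟩) ≠ 0 := fun h =>
  repr_jordan_self_ne_zero K hlam p m (by rw [h, map_zero, Finsupp.zero_apply])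

/-- **THE JORDAN VECTORS `J_0, …, J_n` ARE LINEARLY INDEPENDENT** (characteristic `p`, `λ ≠ 0`; triangular with pivot `m`). -/
theorem linearIndependent_jordan {lam : K} (hlam : lam ≠ 0) (p : ℕ) [Fact p.Prime] [CharP K p] :
    LinearIndependent K fun m : Fin (n + 1) => ((SbC K 1 lam 0 1 - 1) ^ ((m : ℕ) % p)) (spikeBasis K n ⟨p * ((m : ℕ) / p), mul_div_lt_succ p m⟩) :=
  linearIndependent_of_pivot K _ id Function.injective_id (fun m a ha => repr_jordan_of_lt K lam p m a ha) fun m => repr_jordan_self_ne_zero K hlam p m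

/-- **… AND SPAN TH-7's CLASS SPACE: a JORDAN BASIS of the shear** (`n + 1` independent vectors). -/
theorem span_jordan_eq_top {lam : K} (hlam : lam ≠ 0) (p : ℕ) [Fact p.Prime] [CharP K p] :
    Submodule.span K (Set.range fun m : Fin (n + 1) => ((SbC K 1 lam 0 1 - 1) ^ ((m : ℕ) % p)) (spikeBasis K n ⟨p * ((m : ℕ) / p), mul_div_lt_succ p m⟩)) = ⊤ :=
  (linearIndependent_jordan K hlam p).span_eq_top_of_card_eq_finrank' (by rw [Fintype.card_fin, finrank_eq_card_basis (spikeBasis K n), Fintype.card_fin])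

/-- index arithmetic inside a block: `m mod p + k < p ⇒ ⌊(m+k)/p⌋ = ⌊m/p⌋` and `(m+k) mod p = m mod p + k`. -/
theorem div_mod_add_of_lt {p m k : ℕ} (hp : 0 < p) (h : m % p + k < p) : (m + k) / p = m / p ∧ (m + k) % p = m % p + k :=
  (Nat.div_mod_unique hp).mpr ⟨by rw [Nat.add_right_comm, Nat.mod_add_div m p], h⟩

/-- **INSIDE A BLOCK `N^k J_m = J_{m+k}`** (`m mod p + k < p`, `m + k ≤ n`; every field: `N^k N^{m mod p} E_{p⌊m/p⌋} = N^{(m+k) mod p} E_{p⌊(m+k)/p⌋}`). -/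
theorem pow_shear_sub_one_apply_jordan_of_lt (lam : K) {p : ℕ} (hp : 0 < p) (m : Fin (n + 1)) {k : ℕ} (hk : (m : ℕ) % p + k < p) (hmk : (m : ℕ) + k ≤ n) :
    ((SbC K 1 lam 0 1 - 1) ^ k) (((SbC K 1 lam 0 1 - 1) ^ ((m : ℕ) % p)) (spikeBasis K n ⟨p * ((m : ℕ) / p), mul_div_lt_succ p m⟩)) =
      ((SbC K 1 lam 0 1 - 1) ^ (((⟨(m : ℕ) + k, by omega⟩ : Fin (n + 1)) : ℕ) % p))
        (spikeBasis K n ⟨p * ((((⟨(m : ℕ) + k, by omega⟩ : Fin (n + 1)) : ℕ)) / p), mul_div_lt_succ p _⟩) := by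
  obtain ⟨hd, hm⟩ := div_mod_add_of_lt hp hk
  have e : (⟨p * (((m : ℕ) + k) / p), mul_div_lt_succ p (⟨(m : ℕ) + k, by omega⟩ : Fin (n + 1))⟩ : Fin (n + 1)) = ⟨p * ((m : ℕ) / p), mul_div_lt_succ p m⟩ :=
    Fin.ext (by simp only; rw [hd])
  rw [← Module.End.mul_apply, ← pow_add, add_comm k]
  simp only
  rw [hm, e]

/-- **`N J_m = J_{m+1}` inside a block** (`m mod p + 1 < p`, `m < n`). -/
theorem shear_sub_one_apply_jordan_of_lt (lam : K) {p : ℕ} (hp : 0 < p) (m : Fin (n + 1)) (hk : (m : ℕ) % p + 1 < p) (hmn : (m : ℕ) < n) :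
    (SbC K 1 lam 0 1 - 1) (((SbC K 1 lam 0 1 - 1) ^ ((m : ℕ) % p)) (spikeBasis K n ⟨p * ((m : ℕ) / p), mul_div_lt_succ p m⟩)) =
      ((SbC K 1 lam 0 1 - 1) ^ (((⟨(m : ℕ) + 1, by omega⟩ : Fin (n + 1)) : ℕ) % p))
        (spikeBasis K n ⟨p * ((((⟨(m : ℕ) + 1, by omega⟩ : Fin (n + 1)) : ℕ)) / p), mul_div_lt_succ p _⟩) := by
  rw [← pow_shear_sub_one_apply_jordan_of_lt K lam hp m hk (by omega), pow_one]

/-- **AT THE END OF A BLOCK `N^k J_m = 0`: when `m mod p + k ≥ p` (characteristic `p`: `N^p = 0`) or `m + k > n` (no spike beyond `E_n`).** -/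
theorem pow_shear_sub_one_apply_jordan_eq_zero (lam : K) (p : ℕ) [Fact p.Prime] [CharP K p] (m : Fin (n + 1)) {k : ℕ} (hk : p ≤ (m : ℕ) % p + k ∨ n < (m : ℕ) + k) :
    ((SbC K 1 lam 0 1 - 1) ^ k) (((SbC K 1 lam 0 1 - 1) ^ ((m : ℕ) % p)) (spikeBasis K n ⟨p * ((m : ℕ) / p), mul_div_lt_succ p m⟩)) = 0 := by
  rw [← Module.End.mul_apply, ← pow_add, add_comm k]
  rcases hk with hk | hk
  · rw [← Nat.sub_add_cancel hk, pow_add, SbC_shear_sub_one_pow_char K lam p, mul_zero, LinearMap.zero_apply]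
  · exact SbC_shear_sub_one_pow_spikeBasis_eq_zero K lam (by simp only; have := Nat.div_add_mod (m : ℕ) p; omega)

/-- `N J_m = 0` at the end of a full block: `m mod p = p − 1` (characteristic `p`). -/
theorem shear_sub_one_apply_jordan_eq_zero_of_mod (lam : K) (p : ℕ) [Fact p.Prime] [CharP K p] (m : Fin (n + 1)) (hm : (m : ℕ) % p + 1 = p) :
    (SbC K 1 lam 0 1 - 1) (((SbC K 1 lam 0 1 - 1) ^ ((m : ℕ) % p)) (spikeBasis K n ⟨p * ((m : ℕ) / p), mul_div_lt_succ p m⟩)) = 0 := by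
  have h := pow_shear_sub_one_apply_jordan_eq_zero K lam p m (k := 1) (Or.inl hm.ge)
  rwa [pow_one] at h

/-- `N J_n = 0`: the end of the short block (every characteristic `p`). -/
theorem shear_sub_one_apply_jordan_eq_zero_of_eq (lam : K) (p : ℕ) [Fact p.Prime] [CharP K p] (m : Fin (n + 1)) (hm : (m : ℕ) = n) :
    (SbC K 1 lam 0 1 - 1) (((SbC K 1 lam 0 1 - 1) ^ ((m : ℕ) % p)) (spikeBasis K n ⟨p * ((m : ℕ) / p), mul_div_lt_succ p m⟩)) = 0 := by
  have h := pow_shear_sub_one_apply_jordan_eq_zero K lam p m (k := 1) (Or.inr (by omega))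
  rwa [pow_one] at h

/-! ## §315. The kernel flag and the image flag as spans of Jordan vectors -/

/-- **`J_m ∈ ker N^k ⇔ m mod p + k ≥ p ∨ m + k > n`** (characteristic `p`, `λ ≠ 0`: otherwise `N^k J_m = J_{m+k} ≠ 0`). -/
theorem jordan_mem_ker_pow_iff {lam : K} (hlam : lam ≠ 0) (p : ℕ) [Fact p.Prime] [CharP K p] (m : Fin (n + 1)) (k : ℕ) :
    ((SbC K 1 lam 0 1 - 1) ^ ((m : ℕ) % p)) (spikeBasis K n ⟨p * ((m : ℕ) / p), mul_div_lt_succ p m⟩) ∈ LinearMap.ker ((SbC K 1 lam 0 1 - 1) ^ k) ↔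
      p ≤ (m : ℕ) % p + k ∨ n < (m : ℕ) + k := by
  have hp : p.Prime := Fact.out
  rw [LinearMap.mem_ker]
  constructor
  · intro h
    by_contra hc
    rw [not_or, not_le, not_lt] at hc
    rw [pow_shear_sub_one_apply_jordan_of_lt K lam hp.pos m hc.1 hc.2] at h
    exact jordan_ne_zero K hlam p _ h
  · exact pow_shear_sub_one_apply_jordan_eq_zero K lam p m

/-- **THE KERNEL FLAG: `ker N^k = span{J_m : m mod p + k ≥ p ∨ m + k > n}`** — the top `k` vectors of every chain (characteristic `p`, `λ ≠ 0`, EVERY `k`).  «⊆»: expand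
`v ∈ ker N^k` in the Jordan basis; `N^k` maps the `J_m` outside the set to the DISTINCT basis vectors `J_{m+k}`, so their coefficients vanish. -/
theorem ker_pow_shear_sub_one_eq_span_jordan {lam : K} (hlam : lam ≠ 0) (p : ℕ) [Fact p.Prime] [CharP K p] (k : ℕ) :
    LinearMap.ker ((SbC K 1 lam 0 1 (n := n) - 1) ^ k) =
      Submodule.span K (Set.range fun m : {m : Fin (n + 1) // p ≤ (m : ℕ) % p + k ∨ n < (m : ℕ) + k} =>
        ((SbC K 1 lam 0 1 - 1) ^ (((m : Fin (n + 1)) : ℕ) % p)) (spikeBasis K n ⟨p * ((((m : Fin (n + 1)) : ℕ)) / p), mul_div_lt_succ p (m : Fin (n + 1))⟩)) := by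
  classical
  have hp : p.Prime := Fact.out
  -- the Jordan basis
  let b : Basis (Fin (n + 1)) K (spikeSpan K n) := Basis.mk (linearIndependent_jordan K hlam p) (span_jordan_eq_top K hlam p).ge
  have hb : ∀ m : Fin (n + 1), b m = ((SbC K 1 lam 0 1 - 1) ^ ((m : ℕ) % p)) (spikeBasis K n ⟨p * ((m : ℕ) / p), mul_div_lt_succ p m⟩) := fun m => Basis.mk_apply _ _ m
  apply le_antisymm
  · intro v hv
    rw [LinearMap.mem_ker] at hv
    -- the shift `m ↦ m + k` on the complement of the set, landing on basis vectors
    have himg : ∀ m : Fin (n + 1), ¬ (p ≤ (m : ℕ) % p + k ∨ n < (m : ℕ) + k) →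
        ∃ h : (m : ℕ) + k < n + 1, ((SbC K 1 lam 0 1 - 1) ^ k) (b m) = b ⟨(m : ℕ) + k, h⟩ := fun m hm => by
      rw [not_or, not_le, not_lt] at hm
      exact ⟨by omega, by rw [hb, hb, pow_shear_sub_one_apply_jordan_of_lt K lam hp.pos m hm.1 hm.2]⟩
    -- expand `v`, apply `N^k`
    have hsum : ((SbC K 1 lam 0 1 - 1) ^ k) v = ∑ m : Fin (n + 1), b.repr v m • ((SbC K 1 lam 0 1 - 1) ^ k) (b m) := by
      conv_lhs => rw [← b.sum_repr v]
      rw [map_sum]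
      exact Finset.sum_congr rfl fun m _ => by rw [map_smul]
    -- the coefficient of `v` at an index outside the set vanishes
    have hcoef : ∀ m : Fin (n + 1), ¬ (p ≤ (m : ℕ) % p + k ∨ n < (m : ℕ) + k) → b.repr v m = 0 := by
      intro m hm
      obtain ⟨hlt, he⟩ := himg m hm
      -- read the `b ⟨m + k⟩`-coordinate of `N^k v = 0`
      have h := congrArg (fun f : spikeSpan K n => b.repr f ⟨(m : ℕ) + k, hlt⟩) hv
      simp only [hsum, map_sum, map_smul, map_zero, Finsupp.finsetSum_apply, Finsupp.smul_apply, smul_eq_mul, Finsupp.zero_apply] at h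
      rw [Finset.sum_eq_single m (fun m' _ hm' => ?_) (fun h' => absurd (Finset.mem_univ m) h')] at h
      · rwa [he, Basis.repr_self, Finsupp.single_eq_same, mul_one] at h
      · by_cases hm'' : p ≤ (m' : ℕ) % p + k ∨ n < (m' : ℕ) + k
        · rw [hb m', pow_shear_sub_one_apply_jordan_eq_zero K lam p m' hm'', map_zero, Finsupp.zero_apply, mul_zero]
        · obtain ⟨hlt', he'⟩ := himg m' hm''
          rw [he', Basis.repr_self, Finsupp.single_apply, if_neg, mul_zero]
          intro e
          exact hm' (Fin.ext (by have := congrArg Fin.val e; simp only at this; omega))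
    rw [← b.sum_repr v]
    refine Submodule.sum_mem _ fun m _ => ?_
    by_cases hm : p ≤ (m : ℕ) % p + k ∨ n < (m : ℕ) + k
    · rw [hb]; exact Submodule.smul_mem _ _ (Submodule.subset_span ⟨⟨m, hm⟩, rfl⟩)
    · rw [hcoef m hm, zero_smul]; exact Submodule.zero_mem _
  · rw [Submodule.span_le]
    rintro _ ⟨⟨m, hm⟩, rfl⟩
    exact (jordan_mem_ker_pow_iff K hlam p m k).mpr hm

/-- two Jordan vectors with the same index are equal (transport of the index along `m = m'`). -/
theorem jordan_congr (lam : K) (p : ℕ) {m m' : Fin (n + 1)} (h : m = m') :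
    ((SbC K 1 lam 0 1 - 1) ^ ((m : ℕ) % p)) (spikeBasis K n ⟨p * ((m : ℕ) / p), mul_div_lt_succ p m⟩) =
      ((SbC K 1 lam 0 1 - 1) ^ ((m' : ℕ) % p)) (spikeBasis K n ⟨p * ((m' : ℕ) / p), mul_div_lt_succ p m'⟩) := by
  subst h; rfl

/-- **`J_m ∈ range N^k` when `m mod p ≥ k`** (`J_m = N^k J_{m−k}`; every field). -/
theorem jordan_mem_range_pow_of_le (lam : K) {p : ℕ} (hp : 0 < p) (m : Fin (n + 1)) {k : ℕ} (hk : k ≤ (m : ℕ) % p) :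
    ((SbC K 1 lam 0 1 - 1) ^ ((m : ℕ) % p)) (spikeBasis K n ⟨p * ((m : ℕ) / p), mul_div_lt_succ p m⟩) ∈ LinearMap.range ((SbC K 1 lam 0 1 (n := n) - 1) ^ k) := by
  have hkm : k ≤ (m : ℕ) := le_trans hk (Nat.mod_le _ _)
  have hlt := Nat.mod_lt (m : ℕ) hp
  have hdm := Nat.mod_add_div (m : ℕ) p
  -- `m − k` lies in the same block: `⌊(m−k)/p⌋ = ⌊m/p⌋`, `(m−k) mod p = m mod p − k`
  obtain ⟨-, hmod⟩ : ((m : ℕ) - k) / p = (m : ℕ) / p ∧ ((m : ℕ) - k) % p = (m : ℕ) % p - k := (Nat.div_mod_unique hp).mpr ⟨by omega, by omega⟩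
  have h := pow_shear_sub_one_apply_jordan_of_lt K lam hp (⟨(m : ℕ) - k, by omega⟩ : Fin (n + 1)) (k := k) (by simp only; omega) (by simp only; omega)
  exact ⟨_, h.trans (jordan_congr K lam p (Fin.ext (by simp only; omega)))⟩

/-- **THE IMAGE FLAG: `range N^k = span{J_m : m mod p ≥ k}`** — the bottom vectors of every chain (characteristic `p`, `λ ≠ 0`, every `k`): the image of the Jordan basis under
`N^k` consists of the `J_{m+k}` (`m mod p + k < p`, `m + k ≤ n`) and zeros. -/
theorem range_pow_shear_sub_one_eq_span_jordan {lam : K} (hlam : lam ≠ 0) (p : ℕ) [Fact p.Prime] [CharP K p] (k : ℕ) :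
    LinearMap.range ((SbC K 1 lam 0 1 (n := n) - 1) ^ k) =
      Submodule.span K (Set.range fun m : {m : Fin (n + 1) // k ≤ (m : ℕ) % p} =>
        ((SbC K 1 lam 0 1 - 1) ^ (((m : Fin (n + 1)) : ℕ) % p)) (spikeBasis K n ⟨p * ((((m : Fin (n + 1)) : ℕ)) / p), mul_div_lt_succ p (m : Fin (n + 1))⟩)) := by
  have hp : p.Prime := Fact.out
  apply le_antisymm
  · rw [LinearMap.range_eq_map, ← span_jordan_eq_top K hlam p, Submodule.map_span, Submodule.span_le]
    rintro _ ⟨_, ⟨m, rfl⟩, rfl⟩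
    by_cases hm : p ≤ (m : ℕ) % p + k ∨ n < (m : ℕ) + k
    · rw [pow_shear_sub_one_apply_jordan_eq_zero K lam p m hm]; exact Submodule.zero_mem _
    · rw [not_or, not_le, not_lt] at hm
      rw [pow_shear_sub_one_apply_jordan_of_lt K lam hp.pos m hm.1 hm.2]
      refine Submodule.subset_span ⟨⟨⟨(m : ℕ) + k, by omega⟩, ?_⟩, rfl⟩
      show k ≤ ((m : ℕ) + k) % p
      rw [(div_mod_add_of_lt hp.pos hm.1).2]; omega
  · rw [Submodule.span_le]
    rintro _ ⟨⟨m, hm⟩, rfl⟩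
    exact jordan_mem_range_pow_of_le K lam hp.pos m hm

end Summit.Ventures.HSemireg.Wedge.HankelFrameChange
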